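import Literature.MathematicalPhysics.QuantumFieldTheory.Balaban1983to89.LatticeFieldCalculus
import HarnessLib

/-!
# Route `UnitScaleTilt`, crux K1 «MinimiserStabilityRegPr» (stmt-QuantumFields-19200), route-R E′ path (α′) — the sup-row residue (hK), row (W2) for the assembly (A):
# THE EXPONENTIALLY WEIGHTED TORUS SUM `Σ_x e^{−a·d₁(x,b)} ≤ (2(1 + 1∕a))^d` AND THE `ℓ² → ℓ¹` CONVERTER

Cell `ym3-torus`, D-0154 (3c) twin-width seat `ym-routeR-w2` (gen 5).  THEOREMS ONLY (0 `def`, 0 `sorry`); `--supports stmt-QuantumFields-19200 --as helper`,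
count-neutral.  YM₃ on T³ is a ladder rung (R3), not the Clay problem; nothing here claims the stub, the crux, d = 4 or the gap.

THE POINT (ym-routeR-w6 g5 LOCATE (ii) ∕ (D2′) ✓p658709…: the Agmon bound delivers `‖ω·Δr‖_{ℓ²}` for the peeled corrector with an exponential weight `ω ≍ e^{κ·dist∕ℓ}`; the
kernel bound (hK) wants `‖Δr‖_{ℓ¹}`).  The conversion is Cauchy–Schwarz against `ω⁻¹` plus ONE counting fact, uniform in the torus size: `Σ_x e^{−a·d₁(x,b)} ≤ (2(1+1∕a))^d`
for the `ℓ¹` torus distance `d₁ = Site.tdist` (so `a = 2κ′∕ℓ` gives `≤ (2 + ℓ∕κ′)^d ≍ ℓ^d`, whence `‖Δr‖_{ℓ¹} ≤ ℓ^{d∕2}·‖ωΔr‖_{ℓ²}` up to constants).  The same fact on the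
unit-torus carrier `UT N` is ✓ `B9Thm37GlueTorus.torusSum_tdist1_le` (constant `c₀(α)^d`); this file states it on the `Site P j` carrier of `LatticeFieldCalculus` with an
explicit constant, for the (A) seat.

WHAT IS PROVED (ns `…Theorems.Prop7TorusExpWeightSum`; `Site P j`, `Site.tdist`).
* `exp_neg_mul_min_le` (`e^{−a·min(p,q)} ≤ e^{−ap} + e^{−aq}`), `sum_exp_neg_mul_val_le` (`Σ_{s ∈ ℤ∕N} e^{−a·s.val} ≤ 1 + 1∕a`), `sum_coord_le`
  (`Σ_{t ∈ ℤ∕N} e^{−a·min((t−c).val,(c−t).val)} ≤ 2(1+1∕a)`), `exp_neg_mul_tdist_eq_prod` (coordinatewise factorisation).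
* ★★★ `sum_exp_neg_mul_tdist_le` — `Σ_{x ∈ T^{(j)}} e^{−a·tdist(x,b)} ≤ (2(1+1∕a))^d` (`a > 0`), ★★ `sum_exp_neg_tdist_div_le` — the scale-ℓ form `a = 2κ∕ℓ`:
  `Σ_x e^{−(2κ∕ℓ)·tdist(x,b)} ≤ (2 + ℓ∕κ)^d`.
* ★★ `sum_abs_le_sqrt_mul_sqrt` — `Σ_x |g x| ≤ √(Σ_x (ω x)⁻²)·√(Σ_x (ω x·g x)²)` for a positive weight.
HONEST SCOPE.  Folklore counting; the admissible smooth weight (W1) and the assembly (A) are NOT here.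

References: T. Bałaban, CMP 96 (1984) 223–250 [Balaban1984PropagatorsII] ((2.61), c₀(α) pp.233–234).
-/

set_option autoImplicit false

noncomputable section

open scoped BigOperators

namespace Summit.QuantumFields.YangMills.Theorems.Prop7TorusExpWeightSum

open Literature.MathematicalPhysics.QuantumFieldTheory.Balaban1983to89
open Finset

variable {P : Params} {j : ℕ}

/-- `e^{−a·min(p,q)} ≤ e^{−ap} + e^{−aq}`. [folklore] -/
theorem exp_neg_mul_min_le (a : ℝ) (p q : ℕ) :
    Real.exp (-(a * (min p q : ℕ))) ≤ Real.exp (-(a * p)) + Real.exp (-(a * q)) := by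
  rcases le_total p q with h | h
  · rw [min_eq_left h]; linarith [Real.exp_pos (-(a * q))]
  · rw [min_eq_right h]; linarith [Real.exp_pos (-(a * p))]

/-- the half-line geometric sum through the residues: `Σ_{s ∈ ℤ∕N} e^{−a·s.val} ≤ 1 + 1∕a` (`a > 0`). [cite: Balaban1984PropagatorsII, p.233] -/
theorem sum_exp_neg_mul_val_le {N : ℕ} [NeZero N] {a : ℝ} (ha : 0 < a) :
    ∑ s : ZMod N, Real.exp (-(a * (s.val : ℝ))) ≤ 1 + 1 / a := by
  classical
  set r : ℝ := Real.exp (-a) with hr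
  have hr0 : 0 ≤ r := (Real.exp_pos _).le
  have hr1 : r < 1 := by
    rw [hr]; calc Real.exp (-a) < Real.exp 0 := Real.exp_lt_exp.mpr (by linarith)
      _ = 1 := Real.exp_zero
  have hterm : ∀ n : ℕ, Real.exp (-(a * (n : ℝ))) = r ^ n := by
    intro n; rw [hr, ← Real.exp_nat_mul]; congr 1; ring
  -- through the injective label map `val`
  have h1 : ∑ s : ZMod N, Real.exp (-(a * (s.val : ℝ))) = ∑ n ∈ (Finset.univ : Finset (ZMod N)).image ZMod.val, r ^ n := by
    rw [Finset.sum_image (fun x _ y _ h => ZMod.val_injective N h)]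
    exact Finset.sum_congr rfl fun s _ => hterm s.val
  have h2 : ∑ n ∈ (Finset.univ : Finset (ZMod N)).image ZMod.val, r ^ n ≤ ∑' n : ℕ, r ^ n :=
    (summable_geometric_of_lt_one hr0 hr1).sum_le_tsum _ fun n _ => pow_nonneg hr0 n
  rw [h1]
  refine h2.trans ?_
  rw [tsum_geometric_of_lt_one hr0 hr1]
  -- `(1 − e^{−a})⁻¹ ≤ 1 + 1∕a` from `e^{a} ≥ 1 + a`
  have hexp : 1 + a ≤ Real.exp a := by linarith [Real.add_one_le_exp a]
  have hra : r * (1 + a) ≤ 1 := by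
    rw [hr, Real.exp_neg]
    rw [inv_mul_le_iff₀ (Real.exp_pos a)]; linarith
  have h1r : 0 < 1 - r := by linarith
  rw [inv_le_iff_one_le_mul₀ h1r]
  have e : (1 + 1 / a) * (1 - r) = 1 + (1 - r * (1 + a)) / a := by field_simp; ring
  rw [e]
  have : 0 ≤ (1 - r * (1 + a)) / a := div_nonneg (by linarith) ha.le
  linarith

/-- one coordinate of the torus: `Σ_{t ∈ ℤ∕N} e^{−a·min((t−c).val, (c−t).val)} ≤ 2(1 + 1∕a)`. [cite: Balaban1984PropagatorsII, p.233] -/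
theorem sum_coord_le {N : ℕ} [NeZero N] (c : ZMod N) {a : ℝ} (ha : 0 < a) :
    ∑ t : ZMod N, Real.exp (-(a * ((min (t - c).val (c - t).val : ℕ) : ℝ))) ≤ 2 * (1 + 1 / a) := by
  have hsplit : ∑ t : ZMod N, Real.exp (-(a * ((min (t - c).val (c - t).val : ℕ) : ℝ)))
      ≤ ∑ t : ZMod N, Real.exp (-(a * ((t - c).val : ℝ))) + ∑ t : ZMod N, Real.exp (-(a * ((c - t).val : ℝ))) := by
    rw [← Finset.sum_add_distrib]
    exact Finset.sum_le_sum fun t _ => exp_neg_mul_min_le a _ _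
  have hA : ∑ t : ZMod N, Real.exp (-(a * ((t - c).val : ℝ))) = ∑ s : ZMod N, Real.exp (-(a * (s.val : ℝ))) :=
    Fintype.sum_equiv (Equiv.subRight c) _ _ fun t => rfl
  have hB : ∑ t : ZMod N, Real.exp (-(a * ((c - t).val : ℝ))) = ∑ s : ZMod N, Real.exp (-(a * (s.val : ℝ))) :=
    Fintype.sum_equiv (Equiv.subLeft c) _ _ fun t => rfl
  rw [hA, hB] at hsplit
  have h := sum_exp_neg_mul_val_le (N := N) ha
  linarith

/-- coordinatewise factorisation: `e^{−a·tdist(x,b)} = Π_μ e^{−a·min((x_μ−b_μ).val,(b_μ−x_μ).val)}`. [folklore] -/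
theorem exp_neg_mul_tdist_eq_prod (a : ℝ) (x b : Site P j) :
    Real.exp (-(a * (Site.tdist x b : ℝ))) = ∏ μ : Fin P.d, Real.exp (-(a * ((min (x μ - b μ).val (b μ - x μ).val : ℕ) : ℝ))) := by
  rw [← Real.exp_sum]
  congr 1
  simp only [Site.tdist, Nat.cast_sum, Finset.mul_sum, Finset.sum_neg_distrib]

/-- ★★★ **THE EXPONENTIALLY WEIGHTED TORUS SUM**: for `a > 0` and every base point `b`, `Σ_{x ∈ T^{(j)}} e^{−a·tdist(x,b)} ≤ (2(1+1∕a))^d`, uniformly in the torus size.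
[cite: Balaban1984PropagatorsII, (2.61) p.234] -/
theorem sum_exp_neg_mul_tdist_le (b : Site P j) {a : ℝ} (ha : 0 < a) :
    ∑ x : Site P j, Real.exp (-(a * (Site.tdist x b : ℝ))) ≤ (2 * (1 + 1 / a)) ^ P.d := by
  classical
  calc ∑ x : Site P j, Real.exp (-(a * (Site.tdist x b : ℝ)))
      = ∑ x : Site P j, ∏ μ : Fin P.d, Real.exp (-(a * ((min (x μ - b μ).val (b μ - x μ).val : ℕ) : ℝ))) :=
        Finset.sum_congr rfl fun x _ => exp_neg_mul_tdist_eq_prod a x b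
    _ = ∏ μ : Fin P.d, ∑ t : ZMod (P.sitesPerDir j), Real.exp (-(a * ((min (t - b μ).val (b μ - t).val : ℕ) : ℝ))) :=
        (Fintype.prod_sum (fun μ (t : ZMod (P.sitesPerDir j)) => Real.exp (-(a * ((min (t - b μ).val (b μ - t).val : ℕ) : ℝ))))).symm
    _ ≤ ∏ _μ : Fin P.d, (2 * (1 + 1 / a)) := by
        apply Finset.prod_le_prod
        · intro μ _; exact Finset.sum_nonneg fun t _ => (Real.exp_pos _).le
        · intro μ _; exact sum_coord_le (b μ) ha
    _ = (2 * (1 + 1 / a)) ^ P.d := by rw [Finset.prod_const, Finset.card_univ, Fintype.card_fin]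

/-- ★★ **SCALE-ℓ FORM**: `Σ_x e^{−(2κ∕ℓ)·tdist(x,b)} ≤ (2 + ℓ∕κ)^d` (`κ, ℓ > 0`) — `≍ ℓ^d`, the volume of an ℓ-block, uniformly in the torus size.
[cite: Balaban1984PropagatorsII, (2.61) p.234] -/
theorem sum_exp_neg_tdist_div_le (b : Site P j) {κ ℓ : ℝ} (hκ : 0 < κ) (hℓ : 0 < ℓ) :
    ∑ x : Site P j, Real.exp (-(2 * κ / ℓ * (Site.tdist x b : ℝ))) ≤ (2 + ℓ / κ) ^ P.d := by
  have h := sum_exp_neg_mul_tdist_le b (a := 2 * κ / ℓ) (by positivity)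
  have e : 2 * (1 + 1 / (2 * κ / ℓ)) = 2 + ℓ / κ := by rw [one_div_div]; ring
  rw [e] at h
  exact h

/-- ★★ **THE `ℓ² → ℓ¹` CONVERTER**: for a positive weight `ω`, `Σ_x |g x| ≤ √(Σ_x (ω x)⁻²)·√(Σ_x (ω x·g x)²)` (Cauchy–Schwarz). [folklore] -/
theorem sum_abs_le_sqrt_mul_sqrt {ι : Type*} (s : Finset ι) (ω g : ι → ℝ) (hω : ∀ x ∈ s, 0 < ω x) :
    ∑ x ∈ s, |g x| ≤ Real.sqrt (∑ x ∈ s, (ω x)⁻¹ ^ 2) * Real.sqrt (∑ x ∈ s, (ω x * g x) ^ 2) := by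
  have hcs := Finset.sum_mul_sq_le_sq_mul_sq s (fun x => (ω x)⁻¹) (fun x => ω x * |g x|)
  have e : ∀ x ∈ s, (ω x)⁻¹ * (ω x * |g x|) = |g x| := fun x hx => by
    have := (hω x hx).ne'; field_simp
  rw [Finset.sum_congr rfl e] at hcs
  have e2 : ∑ x ∈ s, (ω x * |g x|) ^ 2 = ∑ x ∈ s, (ω x * g x) ^ 2 :=
    Finset.sum_congr rfl fun x _ => by rw [mul_pow, mul_pow, sq_abs]
  rw [e2] at hcs
  have h0 : 0 ≤ ∑ x ∈ s, |g x| := Finset.sum_nonneg fun _ _ => abs_nonneg _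
  calc ∑ x ∈ s, |g x| = Real.sqrt ((∑ x ∈ s, |g x|) ^ 2) := (Real.sqrt_sq h0).symm
    _ ≤ Real.sqrt ((∑ x ∈ s, (ω x)⁻¹ ^ 2) * ∑ x ∈ s, (ω x * g x) ^ 2) := Real.sqrt_le_sqrt hcs
    _ = Real.sqrt (∑ x ∈ s, (ω x)⁻¹ ^ 2) * Real.sqrt (∑ x ∈ s, (ω x * g x) ^ 2) :=
        Real.sqrt_mul (Finset.sum_nonneg fun _ _ => sq_nonneg _) _

end Summit.QuantumFields.YangMills.Theorems.Prop7TorusExpWeightSum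

end
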